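import Literature.Topology.FourManifolds.CobordismEndOrientations
import HarnessLib

/-!
# The ends of a `ℤ`-oriented cobordism, without connectivity: local generators, a two-component
# end, and Thom's isotropy identity read on the components

Topic `Literature/Topology/FourManifolds`.  Prove-seat of Wall's theorem
`Literature.Topology.FourManifolds.isHCobordant_of_equivalent_intersectionForm` (Wall 1964,
Thm. 2), homological half of its parity step C4: Thom's isotropy theorem (Ann. Sci. ENS 69
(1952), Thm. V.7, easy half; in the tree `Cobordism.intersectionForm_eq_of_mem_boundaryImage`)
is to be applied to the upper slab of the punctured cylinder `X × I ∖ B⁵`, a cobordism from the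
level `M_{1/2}` to the DISCONNECTED end `X ⊔ X`, for which the tree's
`Cobordism.exists_orientations_δ_eq` (`CobordismEndOrientations.lean`, connected ends) does not
apply.  This file supplies the variant:

* `Cobordism.exists_δ_eq_add_of_isRelFundamentalClass` — for any cobordism `c` from `M` to `N`
  (`n ≠ 0`, no connectivity) and a relative fundamental class `z`: `∂z = (inl)_* u + (inr)_* v`
  with `u`, `v` local generators at every point (first half of the proof of
  `Cobordism.exists_orientations_δ_eq`, verbatim; Hatcher §3.3 p. 253, Spanier Cor. 6.3.10);
* `exists_eq_map_add_map_of_isGenerator_toLocal` — on `P ≃ A ⊔ B` with `A`, `B` closed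
  connected oriented, a top class which is a local generator everywhere is
  `(ι_A)_*(±[A]) + (ι_B)_*(±[B])` after transport (Hatcher Prop. 2.6, Thm. 3.26);
* `Cobordism.kronecker_cup_inl_add_eq_zero` — **Thom's isotropy read on the components**: with
  `∂z = (inl)_* u + (inr)_* v`, `e_* v = (ι_A)_* a + (ι_B)_* b` and `S, T ∈ Hᵏ(W; ℤ)`,
  `k + k = n`:  `⟨inl^*S ⌣ inl^*T, u⟩ + ⟨j_A^*S ⌣ j_A^*T, a⟩ + ⟨j_B^*S ⌣ j_B^*T, b⟩ = 0`
  (`i_* ∂z = 0`, naturality of `⌣` and of the Kronecker pairing).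

Everything is proved; no definitions, no named facts.

## References

* R. Thom, *Espaces fibrés en sphères et carrés de Steenrod*, Ann. Sci. ENS 69 (1952), Thm. V.7
  (p. 173). [Thom1952]
* A. Hatcher, *Algebraic Topology*, CUP 2002, Prop. 2.6, Prop. 3.10, §3.1 p. 201, Thm. 3.26,
  §3.3 p. 253. [HatcherAT2002]
* E. H. Spanier, *Algebraic Topology*, Springer 1981, Ch. 6 §3, Cor. 10. [Spanier1981]
-/

open scoped Manifold
open Set CategoryTheory Topology Literature.AlgebraicTopology.SingularHomology
open Literature.AlgebraicTopology.SingularHomology.SingularSimplex (sumInl sumInr)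

noncomputable section

universe u

namespace Literature.Topology.FourManifolds

section Cobordism

variable {n : ℕ} {M N : Type u}
  [TopologicalSpace M] [CompactSpace M] [T2Space M] [ChartedSpace (EuclideanSpace ℝ (Fin n)) M]
  [TopologicalSpace N] [CompactSpace N] [T2Space N] [ChartedSpace (EuclideanSpace ℝ (Fin n)) N]

/-- **A relative fundamental class of a cobordism restricts to local generators on both ends**
(Hatcher 2002, §3.3 p. 253; Spanier 1981, Cor. 6.3.10), with no connectivity hypothesis on the
ends: for a cobordism `c` from `M` to `N` of dimension `n ≠ 0` and a relative fundamental class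
`z ∈ Hₙ₊₁(W, ∂W; ℤ)` there are classes `u ∈ Hₙ(M; ℤ)`, `v ∈ Hₙ(N; ℤ)`, local generators at
every point, with `∂z = (inl)_* u + (inr)_* v` in `Hₙ(∂W; ℤ)` (first half of the proof of
`Cobordism.exists_orientations_δ_eq`, verbatim). [cite: HatcherAT2002, §3.3 p. 253] [cite: Spanier1981, Ch. 6 Sec. 3 Cor. 10] -/
theorem Cobordism.exists_δ_eq_add_of_isRelFundamentalClass (hn : n ≠ 0) (c : Cobordism n M N)
    {z : relativeSingularHomology ℤ ℤ c.W ((𝓡∂ (n + 1)).boundary c.W) (n + 1)}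
    (hz : IsRelFundamentalClass ℤ ((𝓡∂ (n + 1)).boundary c.W) z) :
    ∃ (u : singularHomology ℤ ℤ M n) (v : singularHomology ℤ ℤ N n),
      (∀ x : M, ∃ f : localHomology ℤ ℤ M x n ≃ₗ[ℤ] ℤ, f (singularHomology.toLocal ℤ ℤ x n u) = 1) ∧
      (∀ y : N, ∃ f : localHomology ℤ ℤ N y n ≃ₗ[ℤ] ℤ, f (singularHomology.toLocal ℤ ℤ y n v) = 1) ∧
      relativeSingularHomology.δ ℤ ℤ c.W ((𝓡∂ (n + 1)).boundary c.W) n z =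
        singularHomology.map ℤ ℤ c.inlBoundary n u + singularHomology.map ℤ ℤ c.inrBoundary n v := by
  -- transport `∂z` to `Hₙ(M ⊔ N)` along `∂W ≅ M ⊔ N` and split it
  have hed : singularHomology.map ℤ ℤ (c.boundaryHomeomorph : C(M ⊕ N, ↥((𝓡∂ (n + 1)).boundary c.W))) n
      (singularHomology.map ℤ ℤ
        (c.boundaryHomeomorph.symm : C(↥((𝓡∂ (n + 1)).boundary c.W), M ⊕ N)) n
        (relativeSingularHomology.δ ℤ ℤ c.W ((𝓡∂ (n + 1)).boundary c.W) n z)) =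
      relativeSingularHomology.δ ℤ ℤ c.W ((𝓡∂ (n + 1)).boundary c.W) n z := by
    rw [← ModuleCat.comp_apply, ← singularHomology.map_comp]
    have : (c.boundaryHomeomorph : C(M ⊕ N, ↥((𝓡∂ (n + 1)).boundary c.W))).comp
        (c.boundaryHomeomorph.symm : C(↥((𝓡∂ (n + 1)).boundary c.W), M ⊕ N)) =
        ContinuousMap.id _ :=
      ContinuousMap.ext fun x => c.boundaryHomeomorph.apply_symm_apply x
    rw [this, singularHomology.map_id, ModuleCat.id_apply]
  obtain ⟨⟨u, v⟩, huv⟩ := (singularHomology.sumMap_bijective (R := ℤ) (M := ℤ) (X := M) (Y := N) n).2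
    (singularHomology.map ℤ ℤ
      (c.boundaryHomeomorph.symm : C(↥((𝓡∂ (n + 1)).boundary c.W), M ⊕ N)) n
      (relativeSingularHomology.δ ℤ ℤ c.W ((𝓡∂ (n + 1)).boundary c.W) n z))
  rw [singularHomology.sumMap_apply] at huv
  -- `∂z` is a local generator at every boundary point (Spanier Cor. 6.3.10) ...
  have hgen := isGenerator_toLocal_δ_of_isRelFundamentalClass_holds_of_ne_zero ℤ hn z hz
  -- ... hence so is its transport, at the points of `M ⊔ N`
  have hgen_d : ∀ p : M ⊕ N, ∃ f : localHomology ℤ ℤ (M ⊕ N) p n ≃ₗ[ℤ] ℤ,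
      f (singularHomology.toLocal ℤ ℤ p n (singularHomology.map ℤ ℤ
        (c.boundaryHomeomorph.symm : C(↥((𝓡∂ (n + 1)).boundary c.W), M ⊕ N)) n
        (relativeSingularHomology.δ ℤ ℤ c.W ((𝓡∂ (n + 1)).boundary c.W) n z))) = 1 := by
    intro p
    have hmaps : MapsTo (c.boundaryHomeomorph.symm : C(↥((𝓡∂ (n + 1)).boundary c.W), M ⊕ N))
        ({c.boundaryHomeomorph p}ᶜ : Set ↥((𝓡∂ (n + 1)).boundary c.W)) ({p}ᶜ : Set (M ⊕ N)) := by
      intro q hq hq'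
      exact hq (by rw [← hq']; exact (c.boundaryHomeomorph.apply_symm_apply q).symm)
    have hp : (c.boundaryHomeomorph.symm : C(↥((𝓡∂ (n + 1)).boundary c.W), M ⊕ N))
        (c.boundaryHomeomorph p) = p :=
      c.boundaryHomeomorph.symm_apply_apply p
    rw [singularHomology.toLocal_map_apply ℤ ℤ
      (c.boundaryHomeomorph.symm : C(↥((𝓡∂ (n + 1)).boundary c.W), M ⊕ N))
      (c.boundaryHomeomorph p) p hmaps n]
    haveI : IsIso (relativeSingularHomology.map ℤ ℤ
        (c.boundaryHomeomorph.symm : C(↥((𝓡∂ (n + 1)).boundary c.W), M ⊕ N)) hmaps n) := by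
      have h := localHomology.isIso_map_of_isOpenEmbedding ℤ ℤ
        (c.boundaryHomeomorph.symm : C(↥((𝓡∂ (n + 1)).boundary c.W), M ⊕ N))
        c.boundaryHomeomorph.symm.isOpenEmbedding (c.boundaryHomeomorph p)
      rw [hp] at h
      exact h hmaps n
    exact (exists_linearEquiv_apply_eq_one_iff_of_isIso _ _).2 (hgen (c.boundaryHomeomorph p))
  -- `u` is a local generator on `M`, `v` on `N`
  have hgen_u : ∀ x : M, ∃ f : localHomology ℤ ℤ M x n ≃ₗ[ℤ] ℤ,
      f (singularHomology.toLocal ℤ ℤ x n u) = 1 := by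
    intro x
    have h := hgen_d (Sum.inl x)
    rw [← huv, map_add,
      singularHomology.toLocal_map_apply ℤ ℤ (sumInl M N) x (Sum.inl x) (mapsTo_inl_compl_singleton x) n,
      singularHomology.toLocal_map_eq_zero_of_forall_ne ℤ ℤ (sumInr M N) (Sum.inl x)
        (fun _ => Sum.inr_ne_inl) n, add_zero] at h
    haveI := isIso_localHomology_map_inl ℤ (Y := N) x n
    exact (exists_linearEquiv_apply_eq_one_iff_of_isIso _ _).1 h
  have hgen_v : ∀ y : N, ∃ f : localHomology ℤ ℤ N y n ≃ₗ[ℤ] ℤ,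
      f (singularHomology.toLocal ℤ ℤ y n v) = 1 := by
    intro y
    have h := hgen_d (Sum.inr y)
    rw [← huv, map_add,
      singularHomology.toLocal_map_eq_zero_of_forall_ne ℤ ℤ (sumInl M N) (Sum.inr y)
        (fun _ => Sum.inl_ne_inr) n,
      singularHomology.toLocal_map_apply ℤ ℤ (sumInr M N) y (Sum.inr y) (mapsTo_inr_compl_singleton y) n,
      zero_add] at h
    haveI := isIso_localHomology_map_inr ℤ (X := M) y n
    exact (exists_linearEquiv_apply_eq_one_iff_of_isIso _ _).1 h
  -- `∂z = (inl)_* u + (inr)_* v`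
  have hinl : (c.boundaryHomeomorph : C(M ⊕ N, ↥((𝓡∂ (n + 1)).boundary c.W))).comp (sumInl M N) =
      c.inlBoundary :=
    ContinuousMap.ext fun x => c.boundaryHomeomorph_inl x
  have hinr : (c.boundaryHomeomorph : C(M ⊕ N, ↥((𝓡∂ (n + 1)).boundary c.W))).comp (sumInr M N) =
      c.inrBoundary :=
    ContinuousMap.ext fun y => c.boundaryHomeomorph_inr y
  refine ⟨u, v, hgen_u, hgen_v, ?_⟩
  rw [← hed, ← huv, map_add, ← ModuleCat.comp_apply, ← ModuleCat.comp_apply,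
    ← singularHomology.map_comp, ← singularHomology.map_comp, hinl, hinr]

/-- **A top-dimensional class of a closed manifold with two connected components which is a
local generator everywhere is, on each component, `±` the fundamental class**: for
`e : P ≃ₜ A ⊕ B` with `A`, `B` closed connected oriented by `α`, `β`, a class `v ∈ Hₙ(P; ℤ)`
that is a local generator at every point satisfies `e_* v = (ι_A)_* a + (ι_B)_* b` with
`a = ±[A]_α`, `b = ±[B]_β`.
[cite: HatcherAT2002, Prop. 2.6 and Thm. 3.26] -/
theorem exists_eq_map_add_map_of_isGenerator_toLocal {P A B : Type u}
    [TopologicalSpace P] [TopologicalSpace A] [CompactSpace A] [T2Space A]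
    [ChartedSpace (EuclideanSpace ℝ (Fin n)) A] [ConnectedSpace A] [Nonempty A]
    [TopologicalSpace B] [CompactSpace B] [T2Space B]
    [ChartedSpace (EuclideanSpace ℝ (Fin n)) B] [ConnectedSpace B] [Nonempty B]
    (e : P ≃ₜ A ⊕ B) (α : HomologicalOrientation ℤ A n) (β : HomologicalOrientation ℤ B n)
    (v : singularHomology ℤ ℤ P n)
    (hv : ∀ p : P, ∃ f : localHomology ℤ ℤ P p n ≃ₗ[ℤ] ℤ, f (singularHomology.toLocal ℤ ℤ p n v) = 1) :
    ∃ (a : singularHomology ℤ ℤ A n) (b : singularHomology ℤ ℤ B n),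
      (a = α.fundamentalClass ∨ a = -α.fundamentalClass) ∧
      (b = β.fundamentalClass ∨ b = -β.fundamentalClass) ∧
      singularHomology.map ℤ ℤ (e : C(P, A ⊕ B)) n v =
        singularHomology.map ℤ ℤ (sumInl A B) n a + singularHomology.map ℤ ℤ (sumInr A B) n b := by
  -- split the transported class
  obtain ⟨⟨a, b⟩, hab⟩ := (singularHomology.sumMap_bijective (R := ℤ) (M := ℤ) (X := A) (Y := B) n).2
    (singularHomology.map ℤ ℤ (e : C(P, A ⊕ B)) n v)
  rw [singularHomology.sumMap_apply] at hab
  -- the transported class is a local generator everywhere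
  have hgen_d : ∀ q : A ⊕ B, ∃ f : localHomology ℤ ℤ (A ⊕ B) q n ≃ₗ[ℤ] ℤ,
      f (singularHomology.toLocal ℤ ℤ q n (singularHomology.map ℤ ℤ (e : C(P, A ⊕ B)) n v)) = 1 := by
    intro q
    have hmaps : MapsTo (e : C(P, A ⊕ B)) ({e.symm q}ᶜ : Set P) ({q}ᶜ : Set (A ⊕ B)) := by
      intro p hp hp'
      exact hp (by rw [← hp']; exact (e.symm_apply_apply p).symm)
    have hq : (e : C(P, A ⊕ B)) (e.symm q) = q := e.apply_symm_apply q
    rw [singularHomology.toLocal_map_apply ℤ ℤ (e : C(P, A ⊕ B)) (e.symm q) q hmaps n]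
    haveI : IsIso (relativeSingularHomology.map ℤ ℤ (e : C(P, A ⊕ B)) hmaps n) := by
      have h := localHomology.isIso_map_of_isOpenEmbedding ℤ ℤ (e : C(P, A ⊕ B))
        e.isOpenEmbedding (e.symm q)
      rw [hq] at h
      exact h hmaps n
    exact (exists_linearEquiv_apply_eq_one_iff_of_isIso _ _).2 (hv (e.symm q))
  have hgen_a : ∀ x : A, ∃ f : localHomology ℤ ℤ A x n ≃ₗ[ℤ] ℤ,
      f (singularHomology.toLocal ℤ ℤ x n a) = 1 := by
    intro x
    have h := hgen_d (Sum.inl x)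
    rw [← hab, map_add,
      singularHomology.toLocal_map_apply ℤ ℤ (sumInl A B) x (Sum.inl x) (mapsTo_inl_compl_singleton x) n,
      singularHomology.toLocal_map_eq_zero_of_forall_ne ℤ ℤ (sumInr A B) (Sum.inl x)
        (fun _ => Sum.inr_ne_inl) n, add_zero] at h
    haveI := isIso_localHomology_map_inl ℤ (Y := B) x n
    exact (exists_linearEquiv_apply_eq_one_iff_of_isIso _ _).1 h
  have hgen_b : ∀ y : B, ∃ f : localHomology ℤ ℤ B y n ≃ₗ[ℤ] ℤ,
      f (singularHomology.toLocal ℤ ℤ y n b) = 1 := by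
    intro y
    have h := hgen_d (Sum.inr y)
    rw [← hab, map_add,
      singularHomology.toLocal_map_eq_zero_of_forall_ne ℤ ℤ (sumInl A B) (Sum.inr y)
        (fun _ => Sum.inl_ne_inr) n,
      singularHomology.toLocal_map_apply ℤ ℤ (sumInr A B) y (Sum.inr y) (mapsTo_inr_compl_singleton y) n,
      zero_add] at h
    haveI := isIso_localHomology_map_inr ℤ (X := A) y n
    exact (exists_linearEquiv_apply_eq_one_iff_of_isIso _ _).1 h
  obtain ⟨x₀⟩ := (inferInstance : Nonempty A)
  obtain ⟨y₀⟩ := (inferInstance : Nonempty B)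
  exact ⟨a, b, eq_fundamentalClass_or_eq_neg_of_isGenerator_toLocal α a x₀ (hgen_a x₀),
    eq_fundamentalClass_or_eq_neg_of_isGenerator_toLocal β b y₀ (hgen_b y₀), hab.symm⟩


omit [CompactSpace M] [T2Space M] [CompactSpace N] [T2Space N] in
/-- **Thom's isotropy with a two-component end** (the computation of
`Cobordism.intersectionForm_eq_of_mem_boundaryImage`, Thom 1952 Thm. V.7 easy half, when the
outgoing end `N ≃ A ⊔ B` is disconnected).  For a cobordism `c` from `M` to `N`, a
homeomorphism `e : N ≃ₜ A ⊕ B`, a relative class `z` with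
`∂z = (inl)_* u + (inr)_* v`, `e_* v = (ι_A)_* a + (ι_B)_* b`, and classes `S, T ∈ Hᵏ(W; ℤ)`,
`k + k = n`: `⟨inl^*S ⌣ inl^*T, u⟩ + ⟨j_A^*S ⌣ j_A^*T, a⟩ + ⟨j_B^*S ⌣ j_B^*T, b⟩ = 0`, where
`j_A = inr ∘ e⁻¹ ∘ ι_A : A → W`, `j_B` likewise (naturality of `⌣` and of the Kronecker pairing,
and `i_* ∂z = 0`). [cite: Thom1952, Thm V.7 (p. 173)] [cite: HatcherAT2002, Prop. 3.10 and §3.1 p. 201] -/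
theorem Cobordism.kronecker_cup_inl_add_eq_zero {k : ℕ} (h : k + k = n) (c : Cobordism n M N)
    {A B : Type u} [TopologicalSpace A] [TopologicalSpace B]
    (e : N ≃ₜ A ⊕ B)
    {z : relativeSingularHomology ℤ ℤ c.W ((𝓡∂ (n + 1)).boundary c.W) (n + 1)}
    {u : singularHomology ℤ ℤ M n} {v : singularHomology ℤ ℤ N n}
    (hz : relativeSingularHomology.δ ℤ ℤ c.W ((𝓡∂ (n + 1)).boundary c.W) n z =
      singularHomology.map ℤ ℤ c.inlBoundary n u + singularHomology.map ℤ ℤ c.inrBoundary n v)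
    {a : singularHomology ℤ ℤ A n} {b : singularHomology ℤ ℤ B n}
    (hv : singularHomology.map ℤ ℤ (e : C(N, A ⊕ B)) n v =
      singularHomology.map ℤ ℤ (sumInl A B) n a + singularHomology.map ℤ ℤ (sumInr A B) n b)
    (S T : singularCohomology ℤ ℤ c.W k) :
    kroneckerPairing ℤ ℤ M n
        (cupProduct h (singularCohomology.map ℤ ℤ (⟨c.inl, c.continuous_inl⟩ : C(M, c.W)) k S)
          (singularCohomology.map ℤ ℤ (⟨c.inl, c.continuous_inl⟩ : C(M, c.W)) k T)) u +
      kroneckerPairing ℤ ℤ A n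
        (cupProduct h
          (singularCohomology.map ℤ ℤ
            ((⟨c.inr, c.continuous_inr⟩ : C(N, c.W)).comp ((e.symm : C(A ⊕ B, N)).comp (sumInl A B))) k S)
          (singularCohomology.map ℤ ℤ
            ((⟨c.inr, c.continuous_inr⟩ : C(N, c.W)).comp ((e.symm : C(A ⊕ B, N)).comp (sumInl A B))) k T)) a +
      kroneckerPairing ℤ ℤ B n
        (cupProduct h
          (singularCohomology.map ℤ ℤ
            ((⟨c.inr, c.continuous_inr⟩ : C(N, c.W)).comp ((e.symm : C(A ⊕ B, N)).comp (sumInr A B))) k S)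
          (singularCohomology.map ℤ ℤ
            ((⟨c.inr, c.continuous_inr⟩ : C(N, c.W)).comp ((e.symm : C(A ⊕ B, N)).comp (sumInr A B))) k T)) b = 0 := by
  -- `i_* ∂z = 0`
  set ι : C(↥((𝓡∂ (n + 1)).boundary c.W), c.W) := ⟨Subtype.val, continuous_subtype_val⟩ with hι
  have h0 : singularHomology.map ℤ ℤ ι n
      (relativeSingularHomology.δ ℤ ℤ c.W ((𝓡∂ (n + 1)).boundary c.W) n z) = 0 := by
    rw [← ModuleCat.comp_apply, relativeSingularHomology.δ_comp_map]
    rfl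
  have hinl : ι.comp c.inlBoundary = ⟨c.inl, c.continuous_inl⟩ := ContinuousMap.ext fun _ => rfl
  have hinr : ι.comp c.inrBoundary = ⟨c.inr, c.continuous_inr⟩ := ContinuousMap.ext fun _ => rfl
  -- `v = e⁻¹_* (ι_A_* a + ι_B_* b)`
  have hv' : v = singularHomology.map ℤ ℤ ((e.symm : C(A ⊕ B, N)).comp (sumInl A B)) n a +
      singularHomology.map ℤ ℤ ((e.symm : C(A ⊕ B, N)).comp (sumInr A B)) n b := by
    have he : singularHomology.map ℤ ℤ (e.symm : C(A ⊕ B, N)) n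
        (singularHomology.map ℤ ℤ (e : C(N, A ⊕ B)) n v) = v := by
      rw [← ModuleCat.comp_apply, ← singularHomology.map_comp]
      have : (e.symm : C(A ⊕ B, N)).comp (e : C(N, A ⊕ B)) = ContinuousMap.id _ :=
        ContinuousMap.ext fun x => e.symm_apply_apply x
      rw [this, singularHomology.map_id, ModuleCat.id_apply]
    rw [← he, hv, map_add, ← ModuleCat.comp_apply, ← ModuleCat.comp_apply,
      ← singularHomology.map_comp, ← singularHomology.map_comp]
  -- push everything into `W`
  rw [hz, map_add, ← ModuleCat.comp_apply, ← ModuleCat.comp_apply, ← singularHomology.map_comp,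
    ← singularHomology.map_comp, hinl, hinr, hv', map_add, ← ModuleCat.comp_apply,
    ← ModuleCat.comp_apply, ← singularHomology.map_comp, ← singularHomology.map_comp] at h0
  -- read `⟨S ⌣ T, ·⟩` on it
  have key := congrArg (fun x => kroneckerPairing ℤ ℤ c.W n (cupProduct h S T) x) h0
  simp only [map_add, map_zero] at key
  rw [← kroneckerPairing_map, ← kroneckerPairing_map, ← kroneckerPairing_map,
    cupProduct_map, cupProduct_map, cupProduct_map] at key
  rw [add_assoc]
  exact key

end Cobordism

end Literature.Topology.FourManifolds

end
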